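import Literature.Probability.LatticeModels.FKCylinderFamily
import Literature.Probability.LatticeModels.FKFamilyPassage
import Literature.Probability.LatticeModels.FKIsingHalfPlaneArm
import Literature.Probability.LatticeModels.PhantomSegmentBarrier
import HarnessLib

/-!
# The slit-domain observable of the three-sided box: levels, `Hb ≤ H_B`, the phantom supersolution, Lemma 12

Topic `Literature/Probability/LatticeModels`; fifth instalment of the slit-domain observable theory
for the named fact `fkIsing_rsw` (after `FKFamilyObservable`, `FKFamilyPrimitive`, `FKFamilyPassage`,
`FKCylinderFamily`). The abstract theory is specialised to the Dobrushin data of the proof of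
Duminil-Copin–Hongler–Nolin's Lemma 15 / Duminil-Copin 2013, Lemma 10.7: the three-sided box
`threeSided W H` (`LatticeDobrushinBox.lean`: the box `[0, W] × [-1, H]`, wired on its left column,
top row and right column, the bottom row `{x₁ = -1}` being the sacrificial free arc) and, for the
slit domain, the prefix cylinder `cylFamily hE ω₀ n` of its exploration.

* Levels of a family primitive `(Hw, Hb)` of the box (any nonempty family `C`): `Hw` is constant on
  the wired arc (`hwF_eq_of_mem_A`, along the `A`–`A` edges, forced open in every family) and on the
  free arc (`hwF_eq_of_mem_zdArcB`), `hcA_thrF`, `hcB_thrF`, and `H_B = H_A + 1` (`levelB_thrF`).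
* For the cylinder: **`hbF_le_levelB`** — `Hb ≤ H_B` on every inner face (`IsFamilyPrimitive.hb_le`
  with the boundary-layer input `hb_le_of_not_isFamilyFreeEdge` of `FKCylinderFamily`).
* **`phantomLaplacian_cyl_nonpos`** — at a face `g` of `[0, W-1] × [0, H-1]` all of whose sides
  that are not forced open in the cylinder are family-interior, `u∘ = H_B - Hb` is an
  `L_{P,1}`-supersolution for the phantom directions `cylPhantomDirs` = the directions across the
  sides forced open in the cylinder (the original wired arc **and the wired bank of the prefix**;
  `phantom_laplacian_hbC` + `phantomLaplacian_nonpos_of_hb`, the corners of a forced-open side being at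
  the wired level: `A`-sites, or left vertices of the prefix by `exists_exploredEdge_of_isForcedOpen`
  and `hw_orbit_eq`).
* **`levelB_sub_hb_le_famProb_sq`** — Lemma 12 for the cylinder at a point `x = (X, 0)` of the free
  row: `H_B - Hb(f) ≤ P_C(x ↔ wired arc)²` for every face `f` at `x`.

Everything here is proved; no named fact is introduced; nothing assumes `fkIsing_rsw`.

## References

* H. Duminil-Copin, C. Hongler, P. Nolin, Comm. Pure Appl. Math. 64 (2011), §3.1 (Proposition 8,
  eq. (modified_laplacian)), §4 (Lemma 12, proof of Lemma 15) — bib key `DuminilCopinHonglerNolin2011`.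
* H. Duminil-Copin, *Parafermionic observables and their applications*, Ensaios Mat. 25 (2013),
  Prop. 10.2, proof of Lemma 10.7.
-/

noncomputable section

namespace Literature.Probability.LatticeModels

open Complex Finset

namespace LatticeDobrushin

variable {W H : ℕ}

/-! ### Levels of a family primitive of the three-sided box -/

section Levels

variable (hW : 1 ≤ W) (hH : 1 ≤ H) {C : Finset (Finset (Sym2 (meshDomain (threeSided W H).toDobrushin.Ω (threeSided W H).toDobrushin.δ)))}
  {Hw Hb : Site 2 → ℝ} (h : IsFamilyPrimitive (isZdAdmissible_threeSided hW hH) C Hw Hb)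
include h

/-- `Hw` is constant across an `A`–`A` edge one of whose faces is inner (family version of
`IsFKPrimitive.hw_eq_hw_of_arcA`). [cite: Smirnov2010, Lemma 4.11] -/
theorem hwF_eq_hw_of_arcA {u : Site 2} {k : Fin 4} (hu : u ∈ (threeSided W H).toDobrushin.zdArcA)
    (hu' : u + cornerUnit k ∈ (threeSided W H).toDobrushin.zdArcA)
    (hf : (threeSided W H).toDobrushin.IsInnerFace (faceAt u k) ∨ (threeSided W H).toDobrushin.IsInnerFace (faceAt u (k + 3))) :
    Hw u = Hw (u + cornerUnit k) := by
  have hz : cSrc (u, k) ∈ (discreteDomainGraph (threeSided W H).toDobrushin.Ω (threeSided W H).toDobrushin.δ).edgeSet :=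
    cSrc_mem_edgeSet_of_isInnerFace hf
  have hAe : ∀ x ∈ cSrc (u, k), x ∈ (threeSided W H).toDobrushin.zdArcA := fun x hx => by
    rcases Sym2.mem_iff.1 hx with rfl | rfl
    · exact hu
    · exact hu'
  rcases hf with hf | hf
  · exact h.hw_eq_hw_of_forcedOpen (isForcedOpen_of_arcA C hz hAe) hf
  · have hfo : IsForcedOpen (D := (threeSided W H).toDobrushin) C (cSrc (u + cornerUnit k, k + 2)) := by
      rw [cSrc_add_cornerUnit_add_two]; exact isForcedOpen_of_arcA C hz hAe
    have hf' : (threeSided W H).toDobrushin.IsInnerFace (faceAt (u + cornerUnit k) (k + 2)) := by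
      rw [faceAt_add_unit_add_two]; exact hf
    have := h.hw_eq_hw_of_forcedOpen hfo hf'
    rw [this, add_assoc, cornerUnit_add_two, add_neg_cancel, add_zero]

/-- `Hw` is constant along the bottom row `B`. [folklore] -/
theorem hwF_bottom_eq (i : ℕ) (hi : (i : ℤ) ≤ W) : Hw ![(i : ℤ), -1] = Hw ![0, -1] := by
  induction i with
  | zero => simp
  | succ i ih =>
    rw [← ih (by push_cast at hi; omega)]
    have hB := zdArcB_threeSided (W := W) (H := H)
    have hf : (threeSided W H).toDobrushin.IsInnerFace ![(i : ℤ), -1] := by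
      rw [isInnerFace_threeSided_iff]; simp; push_cast at hi; omega
    have e1 : faceAt (![(i : ℤ), -1] : Site 2) 0 = ![(i : ℤ), -1] := by simp [faceAt, cornerOff]
    have e2 : faceAt (![((i + 1 : ℕ) : ℤ), -1] : Site 2) 1 = ![(i : ℤ), -1] := by
      funext j; fin_cases j <;> simp [faceAt, cornerOff]
    have h1 := h.hb_eq_hw_of_mem_zdArcB (b := ![(i : ℤ), -1]) (by rw [hB]; simp; omega) (k := 0) (by rw [e1]; exact hf)
    have h2 := h.hb_eq_hw_of_mem_zdArcB (b := ![((i + 1 : ℕ) : ℤ), -1]) (by rw [hB]; simp; push_cast at hi ⊢; omega) (k := 1)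
      (by rw [e2]; exact hf)
    rw [e1] at h1; rw [e2] at h2
    rw [← h1, ← h2]

/-- `Hw` is constant up the left column of the wired arc. [folklore] -/
theorem hwF_left_eq (j : ℕ) (hj : (j : ℤ) ≤ H) : Hw ![0, (j : ℤ)] = Hw ![0, 0] := by
  induction j with
  | zero => simp
  | succ j ih =>
    rw [← ih (by push_cast at hj; omega)]
    have hA := zdArcA_threeSided (W := W) (H := H)
    have e : (![0, (j : ℤ)] : Site 2) + cornerUnit 1 = ![0, ((j + 1 : ℕ) : ℤ)] := by
      funext i; fin_cases i <;> simp [cornerUnit]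
    rw [← e]
    refine (hwF_eq_hw_of_arcA hW hH h ?_ ?_ (Or.inr ?_)).symm
    · rw [hA, mem_threeSided_A]; simp; omega
    · rw [e, hA, mem_threeSided_A]; simp; push_cast at hj ⊢; omega
    · rw [isInnerFace_threeSided_iff]; simp [faceAt, cornerOff]; push_cast at hj; omega

/-- `Hw` is constant along the top row of the wired arc. [folklore] -/
theorem hwF_top_eq (i : ℕ) (hi : (i : ℤ) ≤ W) : Hw ![(i : ℤ), (H : ℤ)] = Hw ![0, (H : ℤ)] := by
  induction i with
  | zero => simp
  | succ i ih =>
    rw [← ih (by push_cast at hi; omega)]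
    have hA := zdArcA_threeSided (W := W) (H := H)
    have e : (![(i : ℤ), (H : ℤ)] : Site 2) + cornerUnit 0 = ![((i + 1 : ℕ) : ℤ), (H : ℤ)] := by
      funext j; fin_cases j <;> simp [cornerUnit]
    rw [← e]
    refine (hwF_eq_hw_of_arcA hW hH h ?_ ?_ (Or.inr ?_)).symm
    · rw [hA, mem_threeSided_A]; simp; omega
    · rw [e, hA, mem_threeSided_A]; simp; push_cast at hi ⊢; omega
    · rw [isInnerFace_threeSided_iff]; simp [faceAt, cornerOff]; push_cast at hi; omega

/-- `Hw` is constant down the right column of the wired arc. [folklore] -/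
theorem hwF_right_eq (m : ℕ) (hm : (m : ℤ) ≤ H) : Hw ![(W : ℤ), (H : ℤ) - m] = Hw ![(W : ℤ), (H : ℤ)] := by
  induction m with
  | zero => simp
  | succ m ih =>
    rw [← ih (by push_cast at hm; omega)]
    have hA := zdArcA_threeSided (W := W) (H := H)
    have e : (![(W : ℤ), (H : ℤ) - m] : Site 2) + cornerUnit 3 = ![(W : ℤ), (H : ℤ) - ((m + 1 : ℕ) : ℤ)] := by
      funext j; fin_cases j <;> simp [cornerUnit]; ring
    rw [← e]
    refine (hwF_eq_hw_of_arcA hW hH h ?_ ?_ (Or.inr ?_)).symm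
    · rw [hA, mem_threeSided_A]; simp; omega
    · rw [e, hA, mem_threeSided_A]; simp; push_cast at hm ⊢; omega
    · rw [isInnerFace_threeSided_iff]; simp [faceAt, cornerOff]; push_cast at hm; omega

/-- **`Hw` is constant on the wired arc**, family version. [folklore] -/
theorem hwF_eq_of_mem_A {a : Site 2} (ha : a ∈ (threeSided W H).A) : Hw a = Hw ![0, 0] := by
  obtain ⟨⟨h0, h0', _, h1'⟩, h1, hwall⟩ := mem_threeSided_A.1 ha
  have htop : Hw ![0, (H : ℤ)] = Hw ![0, 0] := by
    have := hwF_left_eq hW hH h H le_rfl; simpa using this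
  rcases hwall with hx | hx | hx
  · have e : a = ![0, ((a 1).toNat : ℤ)] := by
      rw [Int.toNat_of_nonneg h1]; funext i; fin_cases i <;> simp [hx]
    rw [e, hwF_left_eq hW hH h _ (by rw [Int.toNat_of_nonneg h1]; exact h1')]
  · have e : a = ![(W : ℤ), (H : ℤ) - (((H : ℤ) - a 1).toNat : ℤ)] := by
      rw [Int.toNat_of_nonneg (by omega)]; funext i; fin_cases i <;> simp [hx]
    rw [e, hwF_right_eq hW hH h _ (by rw [Int.toNat_of_nonneg (by omega)]; omega)]
    have := hwF_top_eq hW hH h W le_rfl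
    rw [this, htop]
  · have e : a = ![((a 0).toNat : ℤ), (H : ℤ)] := by
      rw [Int.toNat_of_nonneg h0]; funext i; fin_cases i <;> simp [hx]
    rw [e, hwF_top_eq hW hH h _ (by rw [Int.toNat_of_nonneg h0]; exact h0'), htop]

/-- **`Hw` is constant on the free arc**, family version. [folklore] -/
theorem hwF_eq_of_mem_zdArcB {b : Site 2} (hb : b ∈ (threeSided W H).toDobrushin.zdArcB) : Hw b = Hw ![0, -1] := by
  rw [zdArcB_threeSided] at hb
  obtain ⟨h0, h0', h1⟩ := hb
  have e : b = ![((b 0).toNat : ℤ), -1] := by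
    rw [Int.toNat_of_nonneg h0]; funext i; fin_cases i <;> simp [h1]
  rw [e, hwF_bottom_eq hW hH h _ (by rw [Int.toNat_of_nonneg h0]; exact h0')]

/-- The input `hcA` of `IsFamilyPrimitive.hb_le` for the three-sided box. [folklore] -/
theorem hcA_thrF : ∀ a ∈ (threeSided W H).toDobrushin.zdArcA,
    (∃ k, (threeSided W H).toDobrushin.IsInnerFace (faceAt a k)) →
    Hw a = Hw (DiscreteDobrushin.startCorner (isZdAdmissible_threeSided hW hH)).1 := by
  intro a ha _
  rw [startCorner_threeSided_fst hW hH]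
  rw [zdArcA_threeSided] at ha
  exact hwF_eq_of_mem_A hW hH h ha

/-- The input `hcB` of `IsFamilyPrimitive.hb_le` for the three-sided box. [folklore] -/
theorem hcB_thrF : ∀ b ∈ (threeSided W H).toDobrushin.zdArcB,
    (∃ k, (threeSided W H).toDobrushin.IsInnerFace (faceAt b k)) →
    Hw b = Hw ((DiscreteDobrushin.startCorner (isZdAdmissible_threeSided hW hH)).1 +
      cornerUnit (DiscreteDobrushin.startCorner (isZdAdmissible_threeSided hW hH)).2) := by
  intro b hb _
  rw [startCorner_threeSided_B hW hH]
  exact hwF_eq_of_mem_zdArcB hW hH h hb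

omit h in
/-- **The two levels of a family primitive**: `H_B = Hw (0, -1) = Hw (0, 0) + 1 = H_A + 1` (nonempty
family). [cite: Smirnov2010, Lemma 4.11] -/
theorem levelB_thrF (h : IsFamilyPrimitive (isZdAdmissible_threeSided hW hH) C Hw Hb) (hC : C.Nonempty) :
    Hw ![0, -1] = Hw ![0, 0] + 1 := by
  have := h.jump_startCorner hC
  rwa [startCorner_threeSided_B hW hH, startCorner_threeSided_fst hW hH] at this

end Levels

/-! ### The cylinder of the three-sided box: `Hb ≤ H_B`, the phantom supersolution, Lemma 12 -/

section Cylinder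

variable (hW : 1 ≤ W) (hH : 1 ≤ H) (ω₀ : Percolation.BondConfig (Site 2)) (n : ℕ) {Hw Hb : Site 2 → ℝ}
  (h : IsFamilyPrimitive (isZdAdmissible_threeSided hW hH)
    (DiscreteDobrushin.cylFamily (isZdAdmissible_threeSided hW hH) ω₀ n) Hw Hb)
include h

/-- **`Hb ≤ H_B` on every inner face, for the primitive of the slit-domain observable of the
three-sided box** (any prefix). [cite: Smirnov2010, proof of Lemma 5.2; DuminilCopinHonglerNolin2011, §4] -/
theorem hbF_le_levelB {f : Site 2} (hf : (threeSided W H).toDobrushin.IsInnerFace f) : Hb f ≤ Hw ![0, -1] := by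
  have hE := isZdAdmissible_threeSided hW hH
  have key := h.hb_le DiscreteDobrushin.cylFamily_nonempty (preconnected_zdArcA_threeSided (W := W) (H := H))
    DiscreteDobrushin.cylFamily_subset_powerset (hcA_thrF hW hH h) (hcB_thrF hW hH h)
    (fun u k hint hnot => by
      rw [h.jump_startCorner DiscreteDobrushin.cylFamily_nonempty]
      exact h.hb_le_of_not_isFamilyFreeEdge u k hint hnot) hf
  rwa [startCorner_threeSided_B hW hH] at key

/-- `0 ≤ H_B - Hb` on every inner face. [cite: Smirnov2010, proof of Lemma 5.2] -/
theorem levelB_sub_hbF_nonneg {f : Site 2} (hf : (threeSided W H).toDobrushin.IsInnerFace f) : 0 ≤ Hw ![0, -1] - Hb f :=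
  sub_nonneg.2 (hbF_le_levelB hW hH ω₀ n h hf)

omit h in
/-- **The phantom directions of the slit domain at the face `g`**: the directions `k` across the
sides of `g` that are forced open in the cylinder — the sides on the wired arc and the followed edges
of the prefix (its wired bank). (The side of `g` in the direction `k` joins the corners
`g + cornerOff (k+1)` and `g + cornerOff (k+2)`.) [cite: DuminilCopinHonglerNolin2011, §3.1 and §4, proof of Lemma 15] -/
def cylPhantomDirs (hW : 1 ≤ W) (hH : 1 ≤ H) (ω₀ : Percolation.BondConfig (Site 2)) (n : ℕ) (g : Site 2) : Finset (Fin 4) := by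
  classical
  exact univ.filter fun k => IsForcedOpen (D := (threeSided W H).toDobrushin)
    (DiscreteDobrushin.cylFamily (isZdAdmissible_threeSided hW hH) ω₀ n) (cSrc (g + cornerOff (k + 1), k + 1))

omit h in
/-- Membership in the phantom directions. [cite: DuminilCopinHonglerNolin2011, §3.1] -/
theorem mem_cylPhantomDirs_iff {g : Site 2} {k : Fin 4} :
    k ∈ cylPhantomDirs hW hH ω₀ n g ↔ IsForcedOpen (D := (threeSided W H).toDobrushin)
      (DiscreteDobrushin.cylFamily (isZdAdmissible_threeSided hW hH) ω₀ n) (cSrc (g + cornerOff (k + 1), k + 1)) := by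
  classical
  simp [cylPhantomDirs]

omit h in
/-- **The sides of a face of `[0, W-1] × [0, H-1]`**: each side is an `A`–`A` edge of the wired arc or
an interior edge of the data. [folklore] -/
theorem side_arcA_or_interior {g : Site 2} (hg : 0 ≤ g 0 ∧ g 0 + 1 ≤ (W : ℤ) ∧ 0 ≤ g 1 ∧ g 1 + 1 ≤ (H : ℤ))
    (j : Fin 4) :
    (g + cornerOff j ∈ (threeSided W H).toDobrushin.zdArcA ∧ g + cornerOff j + cornerUnit j ∈ (threeSided W H).toDobrushin.zdArcA) ∨
      (threeSided W H).toDobrushin.IsInteriorEdge (g + cornerOff j) j := by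
  have hA := zdArcA_threeSided (W := W) (H := H)
  have hB := zdArcB_threeSided (W := W) (H := H)
  have hginner : (threeSided W H).toDobrushin.IsInnerFace g := by rw [isInnerFace_threeSided_iff]; omega
  -- coordinates of the two corners of side `j`
  have hc0 := cornerOff_apply_zero_or_one j 0
  have hc1 := cornerOff_apply_zero_or_one j 1
  have hsucc : g + cornerOff j + cornerUnit j = g + cornerOff (j + 1) := by rw [add_cornerOff_succ]
  have hc0' := cornerOff_apply_zero_or_one (j + 1) 0
  have hc1' := cornerOff_apply_zero_or_one (j + 1) 1
  by_cases hAA : g + cornerOff j ∈ (threeSided W H).toDobrushin.zdArcA ∧ g + cornerOff j + cornerUnit j ∈ (threeSided W H).toDobrushin.zdArcA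
  · exact Or.inl hAA
  · right
    have hfj : (threeSided W H).toDobrushin.IsInnerFace (faceAt (g + cornerOff j) j) := by rw [faceAt_add_cornerOff]; exact hginner
    -- the face across side `j` is inner unless side `j` is `A`–`A`
    have hother : (threeSided W H).toDobrushin.IsInnerFace (faceAt (g + cornerOff j) (j + 3)) := by
      rw [faceAt_face_corner_add_three, isInnerFace_threeSided_iff]
      rw [hA, mem_threeSided_A, mem_threeSided_A, hsucc] at hAA
      simp only [Pi.add_apply] at hAA ⊢
      fin_cases j <;> simp [cornerOff, cornerUnit] at hAA ⊢ <;> omega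
    refine ⟨cSrc_mem_edgeSet_of_isInnerFace (Or.inl hfj), fun x hx => ?_, hAA, hfj, hother⟩
    rw [hB]
    simp only [cSrc, Sym2.mem_iff] at hx
    rintro ⟨-, -, hx1⟩
    rcases hx with rfl | rfl
    · simp only [Pi.add_apply] at hx1; omega
    · rw [hsucc] at hx1; simp only [Pi.add_apply] at hx1; omega

/-- **The corners of a side forced open in the cylinder are at the wired level** `H_A = Hw (0,0)`:
either the side is `A`–`A`, or it is a followed explored edge, whose endpoints are left vertices of the
prefix. [cite: DuminilCopinHonglerNolin2011, §4, proof of Lemma 15] -/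
theorem hw_corner_eq_of_isForcedOpen {g : Site 2} (hg : 0 ≤ g 0 ∧ g 0 + 1 ≤ (W : ℤ) ∧ 0 ≤ g 1 ∧ g 1 + 1 ≤ (H : ℤ)) {j : Fin 4}
    (hfo : IsForcedOpen (D := (threeSided W H).toDobrushin)
      (DiscreteDobrushin.cylFamily (isZdAdmissible_threeSided hW hH) ω₀ n) (cSrc (g + cornerOff j, j))) :
    Hw (g + cornerOff j) = Hw ![0, 0] := by
  have hE := isZdAdmissible_threeSided hW hH
  rcases side_arcA_or_interior hg j with hAA | hint
  · rw [zdArcA_threeSided] at hAA; exact hwF_eq_of_mem_A hW hH h hAA.1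
  · obtain ⟨i, hi, he, hopen⟩ := DiscreteDobrushin.exists_exploredEdge_of_isForcedOpen hint hfo
    set p := cornerOrbit ((threeSided W H).toDobrushin.bcBondConfig ω₀) (DiscreteDobrushin.startCorner hE) i with hp
    have he' : cSrc (g + cornerOff j, j) = cSrc (p.1, p.2 + 1) := he
    have hlev : ∀ i' ≤ min n (DiscreteDobrushin.exitTime hE ω₀),
        Hw (cornerOrbit ((threeSided W H).toDobrushin.bcBondConfig ω₀) (DiscreteDobrushin.startCorner hE) i').1 = Hw ![0, 0] := by
      intro i' hi'
      rw [h.hw_orbit_eq i' hi', startCorner_threeSided_fst hW hH]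
    rcases DiscreteDobrushin.eq_or_eq_of_cSrc_eq he' with ⟨h1, -⟩ | ⟨h1, -⟩
    · rw [h1]; exact hlev i hi.le
    · rw [h1]
      have hnext : cornerOrbit ((threeSided W H).toDobrushin.bcBondConfig ω₀) (DiscreteDobrushin.startCorner hE) (i + 1) =
          (p.1 + cornerUnit (p.2 + 1), p.2 + 3) := by
        rw [cornerOrbit_succ, ← hp]; exact nextCorner_of_mem hopen
      have := hlev (i + 1) (Nat.succ_le_of_lt hi)
      rwa [hnext] at this

/-- **The primitive of the slit-domain observable is a supersolution of the phantom Laplacian**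
(DCHN's eq. (modified_laplacian) in the slit domain `R ∖ γ[0,T]`): at a face `g` of
`[0, W-1] × [0, H-1]` all of whose sides that are not forced open in the cylinder are
family-interior, `L_{P,1} (H_B - Hb) (g) ≤ 0` for the phantom directions `P = cylPhantomDirs` (the
wired arc and the wired bank of the prefix), phantom level `1` (= wired, for `u∘ = H_B - Hb`).
[cite: DuminilCopinHonglerNolin2011, §3.1, eq. (modified_laplacian), and §4, proof of Lemma 15] -/
theorem phantomLaplacian_cyl_nonpos {g : Site 2} (hg : 0 ≤ g 0 ∧ g 0 + 1 ≤ (W : ℤ) ∧ 0 ≤ g 1 ∧ g 1 + 1 ≤ (H : ℤ))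
    (hint : ∀ k : Fin 4, k ∉ cylPhantomDirs hW hH ω₀ n g →
      IsFamilyInteriorEdge (DiscreteDobrushin.cylFamily (isZdAdmissible_threeSided hW hH) ω₀ n) (g + cornerOff (k + 1)) (k + 1)) :
    phantomLaplacian (cylPhantomDirs hW hH ω₀ n) 1 (fun f => Hw ![0, -1] - Hb f) g ≤ 0 := by
  classical
  have hE := isZdAdmissible_threeSided hW hH
  set C := DiscreteDobrushin.cylFamily (isZdAdmissible_threeSided hW hH) ω₀ n with hCdef
  have hginner : (threeSided W H).toDobrushin.IsInnerFace g := by rw [isInnerFace_threeSided_iff]; omega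
  -- the side set `P'` (sides forced open) and the DCHN inequality in side form
  set P' : Finset (Fin 4) := univ.filter fun j => IsForcedOpen (D := (threeSided W H).toDobrushin) C (cSrc (g + cornerOff j, j)) with hP'
  have hmemP' : ∀ j, j ∈ P' ↔ IsForcedOpen (D := (threeSided W H).toDobrushin) C (cSrc (g + cornerOff j, j)) := fun j => by
    rw [hP']; simp
  have hdir : ∀ k, k ∈ cylPhantomDirs hW hH ω₀ n g ↔ k + 1 ∈ P' := fun k => by rw [mem_cylPhantomDirs_iff, hmemP']
  have hint' : ∀ j, j ∉ P' → IsFamilyInteriorEdge C (g + cornerOff j) j := by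
    intro j hj
    have := hint (j + 3) (by rw [hdir, show j + 3 + 1 = j by omega]; exact hj)
    rwa [show j + 3 + 1 = j by omega] at this
  have hpair : ∀ j : Fin 4, Hb g - Hw (g + cornerOff j) = dartFluxOn _ hE C (g + cornerOff j, j) := by
    intro j
    have := h (g + cornerOff j, j) (by change (threeSided W H).toDobrushin.IsInnerFace (faceAt (g + cornerOff j) j); rw [faceAt_add_cornerOff]; exact hginner)
    simp only [cFace] at this
    rwa [faceAt_add_cornerOff] at this
  have hpair' : ∀ j, j ∉ P' → Hb (g + cornerUnit (j + 3)) - Hw (g + cornerOff j) = dartFluxOn _ hE C (g + cornerOff j, j + 3) := by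
    intro j hj
    have := h (g + cornerOff j, j + 3) (hint' j hj).inner'
    simp only [cFace] at this
    rwa [faceAt_face_corner_add_three] at this
  have key := phantom_laplacian_hbC hE (preconnected_zdArcA_threeSided (W := W) (H := H)) DiscreteDobrushin.cylFamily_subset_powerset
    g hginner P' hint' (fun j hj => (hmemP' j).1 hj) hpair hpair'
  -- reindex sides to directions
  have hsum1 : ∑ j ∈ univ.filter (· ∉ P'), (Hb (g + cornerUnit (j + 3)) - Hb g) =
      ∑ k ∈ univ.filter (fun k => k ∉ cylPhantomDirs hW hH ω₀ n g), (Hb (g + cornerUnit k) - Hb g) := by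
    refine Finset.sum_bij (fun j _ => j + 3) (fun j hj => ?_) (fun a _ b _ hab => by simpa using hab)
      (fun k hk => ⟨k + 1, ?_, by omega⟩) (fun j _ => rfl)
    · rw [Finset.mem_filter] at hj ⊢
      exact ⟨Finset.mem_univ _, by rw [hdir, show j + 3 + 1 = j by omega]; exact hj.2⟩
    · rw [Finset.mem_filter] at hk ⊢
      exact ⟨Finset.mem_univ _, by rw [hdir] at hk; exact hk.2⟩
  have hsum2 : ∑ j ∈ P', (Hb g - Hw (g + cornerOff j)) = ∑ k ∈ cylPhantomDirs hW hH ω₀ n g, (Hb g - Hw (g + cornerOff (k + 1))) := by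
    refine Finset.sum_bij (fun j _ => j + 3) (fun j hj => ?_) (fun a _ b _ hab => by simpa using hab)
      (fun k hk => ⟨k + 1, (hdir k).1 hk, by omega⟩) (fun j _ => by rw [show j + 3 + 1 = j by omega])
    rw [hdir, show j + 3 + 1 = j by omega]; exact hj
  rw [hsum1, hsum2] at key
  have hAB : Hw ![0, -1] = Hw ![0, 0] + 1 := levelB_thrF hW hH h DiscreteDobrushin.cylFamily_nonempty
  exact phantomLaplacian_nonpos_of_hb (P := cylPhantomDirs hW hH ω₀ n) (HwA := fun k => Hw (g + cornerOff (k + 1))) hAB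
    (fun k hk => hw_corner_eq_of_isForcedOpen hW hH ω₀ n h hg ((mem_cylPhantomDirs_iff hW hH ω₀ n).1 hk)) key

/-- **Lemma 12 for the slit domain of the three-sided box**: at a point `x = (X, 0)` of the free row
(`0 < X < W`), for every face `f` at `x`, `H_B - Hb(f) ≤ P_C(x ↔ wired arc)²`, `P_C` the
conditional probability given the prefix. [cite: DuminilCopinHonglerNolin2011, §4, Lemma 12 and proof of Lemma 15] -/
theorem levelB_sub_hb_le_famProb_sq (X : ℕ) (hX0 : 1 ≤ X) (hXW : (X : ℤ) + 1 ≤ W)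
    (hx : (![(X : ℤ), 0] : Site 2) ∈ meshDomain (threeSided W H).toDobrushin.Ω (threeSided W H).toDobrushin.δ) (k : Fin 4) :
    Hw ![0, -1] - Hb (faceAt ![(X : ℤ), 0] k) ≤
      (famProb (threeSided W H).toDobrushin (DiscreteDobrushin.cylFamily (isZdAdmissible_threeSided hW hH) ω₀ n)
        {ω | (threeSided W H).toDobrushin.OpenJoinedToArcA ⟨![(X : ℤ), 0], hx⟩ ω}) ^ 2 := by
  have hE := isZdAdmissible_threeSided hW hH
  have hc₀ : DiscreteDobrushin.startCorner hE = FreeArcPhase.c₀ 0 := by rw [startCorner_threeSided hW hH]; rfl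
  have hB : (![(X : ℤ), -1] : Site 2) ∈ (threeSided W H).toDobrushin.zdArcB := by rw [zdArcB_threeSided]; simp; omega
  have hall : ∀ j, (threeSided W H).toDobrushin.IsInnerFace (faceAt ![(X : ℤ), 0] j) :=
    isInnerFace_faceAt_threeSided ⟨by simp; omega, by simpa using hXW, by simp, by simp; omega⟩
  have hchain : Relation.ReflTransGen (FreeSideAdj (threeSided W H).toDobrushin)
      (cFace (DiscreteDobrushin.startCorner hE)) (cFace (FreeArcPhase.qX (X : ℤ))) := by
    rw [startCorner_threeSided hW hH]
    have e1 : cFace ((((![0, 0] : Site 2), (3 : Fin 4))) : Site 2 × Fin 4) = ![0, -1] := by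
      show faceAt ![0, 0] 3 = _
      funext i; fin_cases i <;> simp [faceAt, cornerOff]
    have e2 : cFace (FreeArcPhase.qX (X : ℤ)) = ![(X : ℤ), -1] := by
      show faceAt ![(X : ℤ), 0] 3 = _
      funext i; fin_cases i <;> simp [faceAt, cornerOff]
    rw [e1, e2]
    exact reflTransGen_freeSideAdj_threeSided X hXW
  have key := h.sub_hb_le_famProb_openJoined_sq hc₀ (by exact_mod_cast hX0) (fun v hv hvB => height_nonneg_threeSided hv hvB) hB hall
    (preconnected_zdArcA_threeSided (W := W) (H := H)) hx hchain k
  have hlev : Hw ![(X : ℤ), -1] = Hw ![0, -1] := hwF_eq_of_mem_zdArcB hW hH h hB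
  rw [hlev] at key
  exact key

end Cylinder

end LatticeDobrushin

end Literature.Probability.LatticeModels
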